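import Summits.NavierStokesRegularity.NavierStokesRegularity.Theorems.OddMorawetzLocal.Negative.OddMorawetzLocalRefutationDefsFast
import Summits.NavierStokesRegularity.NavierStokesRegularity.Theorems.OddMorawetzOddMorawetzLocalNormCast
import Summits.NavierStokesRegularity.NavierStokesRegularity.Theorems.OddMorawetzOddMorawetzLocalIdxCompleteSort
import HarnessLib

/-!
# The merge-sort normal form `JPoly.normF`, I: merging, sorting and collecting as list combinatorics

Crux `OddMorawetzLocal` (item stmt-NavierStokesRegularity-1376), refutation skeleton (lead c1), first half of the
stub `normF_semantics`; registered helper stub `msort_perm_sorted`.  Pure `List` combinatorics over Mathlib on the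
computable jet polynomials `JPoly R = List (R × List JVar)` and the merge-sort normal form of
`OddMorawetzLocalRefutationDefsFast` (`mergeTerms`, `splitAlt`, `msort`, `collectAcc`, `mergeCollect`, `normF`);
no named facts, no new definitions.  Reuses the landed `eq_of_monoCmp_eq` (`…NormCast`) and the order lemmas
`JVar.cmp_self` / `JVar.cmp_swap` / `JVar.cmp_le_trans` / `JVar.eq_of_cmp_eq_eq` (`…IdxCompleteSort`).

The kernel certificates of the refutation normalise integer jet polynomials with `normF` (sort the variables of
each monomial, merge-sort the monomials by `monoCmp`, add up equal adjacent monomials, drop zeros).  To read an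
identity `normF q = []` or `normF q = normF q'` semantically one needs that every stage only permutes terms, merges
EQUAL monomials or drops zero terms, and that the output is duplicate-free.  This file supplies the list-level
facts, the companion file `…NormFSemantics` the consequences for `evalA` / `coeffOf` and the registered stub.

* `monoCmp` behaves like a linear order: `monoCmp_self`, `monoCmp_swap`, `monoCmp_eq_gt_iff`, `monoCmp_antisymm`,
  `monoCmp_le_trans` (the relation `s ≤ t :↔ monoCmp s t ≠ gt`, written out, never named);
* `mergeTerms_perm`, `splitAlt_perm`, `msort_perm` — merging / splitting / merge-sorting permute the terms;
* `mergeTerms_sorted`, `msort_sorted` — with fuel `≥ length` they sort (`monoCmp`-non-decreasing monomials);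
* `collectAcc_pairwise_lt`, `mergeCollect_pairwise_lt` — collecting a sorted list gives STRICTLY increasing
  monomials (equal adjacent monomials are merged; antisymmetry excludes equal non-adjacent ones);
  `snd_mem_collectAcc`, `snd_mem_mergeCollect` — collecting creates no new monomials;
* `mergeTerms_map`, `splitAlt_map`, `msort_map`, `collectAcc_map`, `mergeCollect_map`, `filter_ne_zero_map`,
  `normF_map` — `normF` commutes with any additive, zero-reflecting map of the coefficients (the casts `ℤ → ℝ`,
  `ℚ → ℝ`): the monomial bookkeeping never looks at coefficients, collecting adds them, the filter tests them.
-/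

noncomputable section

set_option linter.dupNamespace false
set_option autoImplicit false

namespace Summit.NavierStokesRegularity.NavierStokesRegularity.Theorems.OddMorawetz

/-! ### `monoCmp` is a linear order -/

/-- `monoCmp` is reflexive (value `eq` on the diagonal). -/
theorem monoCmp_self (m : List JVar) : monoCmp m m = .eq := by
  induction m with
  | nil => rfl
  | cons v m ih => simp [monoCmp, JVar.cmp_self, ih]

/-- Swapping the arguments of `monoCmp` swaps the answer. -/
theorem monoCmp_swap : ∀ (m m' : List JVar), (monoCmp m m').swap = monoCmp m' m
  | [], [] => rfl
  | [], _ :: _ => rfl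
  | _ :: _, [] => rfl
  | v :: vs, w :: ws => by
    have h := JVar.cmp_swap v w
    simp only [monoCmp]
    cases hc : JVar.cmp v w <;> rw [hc] at h <;> rw [← h] <;> simp [monoCmp_swap vs ws]

/-- `monoCmp m m' = gt ↔ monoCmp m' m = lt`. -/
theorem monoCmp_eq_gt_iff {m m' : List JVar} : monoCmp m m' = .gt ↔ monoCmp m' m = .lt := by
  rw [← monoCmp_swap m' m]
  cases monoCmp m' m <;> decide

/-- Antisymmetry of `≤` (= "not `gt`") for `monoCmp`. -/
theorem monoCmp_antisymm {m m' : List JVar} (h₁ : monoCmp m m' ≠ .gt) (h₂ : monoCmp m' m ≠ .gt) : m = m' := by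
  apply eq_of_monoCmp_eq
  cases h : monoCmp m m' with
  | eq => rfl
  | gt => exact absurd h h₁
  | lt => exact absurd (monoCmp_eq_gt_iff.2 h) h₂

/-- Transitivity of `≤` (= "not `gt`") for `monoCmp`. -/
theorem monoCmp_le_trans : ∀ {a b c : List JVar}, monoCmp a b ≠ .gt → monoCmp b c ≠ .gt → monoCmp a c ≠ .gt
  | [], _, c, _, _ => by cases c <;> simp [monoCmp]
  | _ :: _, [], _, hab, _ => by simp [monoCmp] at hab
  | _ :: _, _ :: _, [], _, hbc => by simp [monoCmp] at hbc
  | v :: as, w :: bs, u :: cs, hab, hbc => by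
    simp only [monoCmp] at hab hbc ⊢
    have hvw : JVar.cmp v w ≠ .gt := fun h => by simp [h] at hab
    have hwu : JVar.cmp w u ≠ .gt := fun h => by simp [h] at hbc
    have hvu : JVar.cmp v u ≠ .gt := JVar.cmp_le_trans hvw hwu
    cases h : JVar.cmp v u with
    | lt => exact (by decide : Ordering.lt ≠ Ordering.gt)
    | gt => exact absurd h hvu
    | eq =>
      obtain rfl := JVar.eq_of_cmp_eq_eq h
      -- then `v = w` by antisymmetry of `JVar.cmp`
      have hw : JVar.cmp v w = .eq := by
        cases h' : JVar.cmp v w with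
        | eq => rfl
        | gt => exact absurd h' hvw
        | lt => exact absurd (JVar.cmp_eq_gt_iff.2 h') hwu
      obtain rfl := JVar.eq_of_cmp_eq_eq hw
      simp only [JVar.cmp_self] at hab hbc
      exact monoCmp_le_trans hab hbc

namespace JPoly

variable {R S : Type}

/-! ### Merging, splitting and merge-sorting permute -/

/-- `mergeTerms fuel p q` is a permutation of `p ++ q`. -/
theorem mergeTerms_perm : ∀ (fuel : ℕ) (p q : List (R × List JVar)), (mergeTerms fuel p q).Perm (p ++ q)
  | 0, p, q => by simp [mergeTerms]
  | _ + 1, [], q => by simp [mergeTerms]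
  | _ + 1, s :: ps, [] => by simp [mergeTerms]
  | fuel + 1, s :: ps, t :: qs => by
    cases h : monoCmp s.2 t.2 <;> simp only [mergeTerms, h]
    · exact (mergeTerms_perm fuel ps (t :: qs)).cons s
    · exact (mergeTerms_perm fuel ps (t :: qs)).cons s
    · exact ((mergeTerms_perm fuel (s :: ps) qs).cons t).trans List.perm_middle.symm

/-- The two halves of `splitAlt p` together are a permutation of `p`. -/
theorem splitAlt_perm : ∀ (p : List (R × List JVar)), ((splitAlt p).1 ++ (splitAlt p).2).Perm p
  | [] => List.Perm.refl _
  | [_] => List.Perm.refl _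
  | a :: b :: rest => by
    simp only [splitAlt, List.cons_append]
    exact (List.perm_middle.trans ((splitAlt_perm rest).cons b)).cons a

/-- Unfolding `splitAlt` on a list with at least two elements. -/
theorem splitAlt_cons_cons (a b : R × List JVar) (rest : List (R × List JVar)) :
    splitAlt (a :: b :: rest) = (a :: (splitAlt rest).1, b :: (splitAlt rest).2) := rfl

/-- The halves of `splitAlt p` are not longer than `p`. -/
theorem length_splitAlt_le (p : List (R × List JVar)) :
    (splitAlt p).1.length ≤ p.length ∧ (splitAlt p).2.length ≤ p.length := by
  have h := (splitAlt_perm p).length_eq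
  rw [List.length_append] at h
  omega

/-- `msort fuel p` is a permutation of `p`. -/
theorem msort_perm : ∀ (fuel : ℕ) (p : List (R × List JVar)), (msort fuel p).Perm p
  | 0, _ => List.Perm.refl _
  | _ + 1, [] => List.Perm.refl _
  | _ + 1, [_] => List.Perm.refl _
  | fuel + 1, a :: b :: rest => by
    simp only [msort]
    exact ((mergeTerms_perm _ _ _).trans ((msort_perm fuel _).append (msort_perm fuel _))).trans
      (splitAlt_perm (a :: b :: rest))

/-! ### Merging sorted lists gives a sorted list; merge sort sorts -/

/-- Merging two `monoCmp`-sorted term lists with enough fuel gives a sorted list. -/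
theorem mergeTerms_sorted : ∀ (fuel : ℕ) (p q : List (R × List JVar)), p.length + q.length ≤ fuel →
    p.Pairwise (fun s t => monoCmp s.2 t.2 ≠ .gt) → q.Pairwise (fun s t => monoCmp s.2 t.2 ≠ .gt) →
    (mergeTerms fuel p q).Pairwise (fun s t => monoCmp s.2 t.2 ≠ .gt)
  | 0, p, q, hl, _, _ => by
    obtain rfl : p = [] := List.eq_nil_of_length_eq_zero (by omega)
    obtain rfl : q = [] := List.eq_nil_of_length_eq_zero (by omega)
    simp [mergeTerms]
  | _ + 1, [], q, _, _, hq => by simpa [mergeTerms] using hq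
  | _ + 1, s :: ps, [], _, hp, _ => by simpa [mergeTerms] using hp
  | fuel + 1, s :: ps, t :: qs, hl, hp, hq => by
    have hp' := List.pairwise_cons.1 hp
    have hq' := List.pairwise_cons.1 hq
    have hl' : ps.length + (t :: qs).length ≤ fuel := by simp only [List.length_cons] at hl ⊢; omega
    have hl'' : (s :: ps).length + qs.length ≤ fuel := by simp only [List.length_cons] at hl ⊢; omega
    cases h : monoCmp s.2 t.2 <;> simp only [mergeTerms, h]
    · refine List.pairwise_cons.2 ⟨fun x hx => ?_, mergeTerms_sorted fuel ps (t :: qs) hl' hp'.2 hq⟩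
      rcases List.mem_append.1 ((mergeTerms_perm fuel ps (t :: qs)).mem_iff.1 hx) with hx | hx
      · exact hp'.1 x hx
      · rcases List.mem_cons.1 hx with rfl | hx
        · simp [h]
        · exact monoCmp_le_trans (by simp [h]) (hq'.1 x hx)
    · refine List.pairwise_cons.2 ⟨fun x hx => ?_, mergeTerms_sorted fuel ps (t :: qs) hl' hp'.2 hq⟩
      rcases List.mem_append.1 ((mergeTerms_perm fuel ps (t :: qs)).mem_iff.1 hx) with hx | hx
      · exact hp'.1 x hx
      · rcases List.mem_cons.1 hx with rfl | hx
        · simp [h]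
        · exact monoCmp_le_trans (by simp [h]) (hq'.1 x hx)
    · have hts : monoCmp t.2 s.2 ≠ .gt := by rw [monoCmp_eq_gt_iff.1 h]; decide
      refine List.pairwise_cons.2 ⟨fun x hx => ?_, mergeTerms_sorted fuel (s :: ps) qs hl'' hp hq'.2⟩
      rcases List.mem_append.1 ((mergeTerms_perm fuel (s :: ps) qs).mem_iff.1 hx) with hx | hx
      · rcases List.mem_cons.1 hx with rfl | hx
        · exact hts
        · exact monoCmp_le_trans hts (hp'.1 x hx)
      · exact hq'.1 x hx

/-- Merge sort with enough fuel sorts. -/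
theorem msort_sorted : ∀ (fuel : ℕ) (p : List (R × List JVar)), p.length ≤ fuel →
    (msort fuel p).Pairwise (fun s t => monoCmp s.2 t.2 ≠ .gt)
  | 0, p, h => by
    obtain rfl : p = [] := List.eq_nil_of_length_eq_zero (by omega)
    exact List.Pairwise.nil
  | _ + 1, [], _ => List.Pairwise.nil
  | _ + 1, [_], _ => List.pairwise_singleton _ _
  | fuel + 1, a :: b :: rest, h => by
    have hlen := length_splitAlt_le rest
    simp only [List.length_cons] at h
    simp only [msort, splitAlt_cons_cons]
    refine mergeTerms_sorted _ _ _ ?_ (msort_sorted fuel _ ?_) (msort_sorted fuel _ ?_)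
    · rw [(msort_perm fuel _).length_eq, (msort_perm fuel _).length_eq]
      have h' := (splitAlt_perm rest).length_eq
      simp only [List.length_append, List.length_cons] at h' ⊢
      omega
    · simp only [List.length_cons]; omega
    · simp only [List.length_cons]; omega

/-! ### The coefficient map commutes with merging and sorting (they never look at coefficients) -/

/-- `mergeTerms` commutes with a map of the coefficients. -/
theorem mergeTerms_map (φ : R → S) : ∀ (fuel : ℕ) (p q : List (R × List JVar)),
    mergeTerms fuel (p.map fun t => (φ t.1, t.2)) (q.map fun t => (φ t.1, t.2)) =
      (mergeTerms fuel p q).map fun t => (φ t.1, t.2)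
  | 0, p, q => by simp [mergeTerms]
  | _ + 1, [], q => by simp [mergeTerms]
  | _ + 1, s :: ps, [] => by simp [mergeTerms]
  | fuel + 1, s :: ps, t :: qs => by
    have ih₁ := mergeTerms_map φ fuel ps (t :: qs)
    have ih₂ := mergeTerms_map φ fuel (s :: ps) qs
    simp only [List.map_cons] at ih₁ ih₂ ⊢
    cases h : monoCmp s.2 t.2 <;> simp only [mergeTerms, h, List.map_cons] <;> first | rw [ih₁] | rw [ih₂]

/-- `splitAlt` commutes with a map of the coefficients. -/
theorem splitAlt_map (φ : R → S) : ∀ (p : List (R × List JVar)),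
    splitAlt (p.map fun t => (φ t.1, t.2)) =
      ((splitAlt p).1.map fun t => (φ t.1, t.2), (splitAlt p).2.map fun t => (φ t.1, t.2))
  | [] => rfl
  | [_] => rfl
  | a :: b :: rest => by
    simp only [List.map_cons, splitAlt_cons_cons, splitAlt_map φ rest]

/-- `msort` commutes with a map of the coefficients. -/
theorem msort_map (φ : R → S) : ∀ (fuel : ℕ) (p : List (R × List JVar)),
    msort fuel (p.map fun t => (φ t.1, t.2)) = (msort fuel p).map fun t => (φ t.1, t.2)
  | 0, _ => rfl
  | _ + 1, [] => rfl
  | _ + 1, [_] => rfl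
  | fuel + 1, a :: b :: rest => by
    have ih₁ := msort_map φ fuel (a :: (splitAlt rest).1)
    have ih₂ := msort_map φ fuel (b :: (splitAlt rest).2)
    simp only [List.map_cons] at ih₁ ih₂
    simp only [List.map_cons, msort, splitAlt_cons_cons, List.length_map, splitAlt_map φ rest]
    rw [ih₁, ih₂, mergeTerms_map]

/-! ### Collecting equal adjacent monomials -/

/-- Every monomial of `collectAcc cur rest` is a monomial of `cur :: rest`. -/
theorem snd_mem_collectAcc [Add R] : ∀ (cur : R × List JVar) (rest : List (R × List JVar)) (t : R × List JVar),
    t ∈ collectAcc cur rest → ∃ s ∈ cur :: rest, t.2 = s.2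
  | cur, [], t, ht => ⟨cur, List.mem_cons_self, by simp only [collectAcc, List.mem_singleton] at ht; rw [ht]⟩
  | cur, u :: rest, t, ht => by
    simp only [collectAcc] at ht
    split_ifs at ht with h
    · obtain ⟨s, hs, hts⟩ := snd_mem_collectAcc _ rest t ht
      rcases List.mem_cons.1 hs with rfl | hs
      · exact ⟨cur, List.mem_cons_self, hts⟩
      · exact ⟨s, List.mem_cons_of_mem _ (List.mem_cons_of_mem _ hs), hts⟩
    · rcases List.mem_cons.1 ht with rfl | ht
      · exact ⟨t, List.mem_cons_self, rfl⟩
      · obtain ⟨s, hs, hts⟩ := snd_mem_collectAcc u rest t ht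
        exact ⟨s, List.mem_cons_of_mem _ hs, hts⟩

/-- Every monomial of `mergeCollect q` is a monomial of `q`. -/
theorem snd_mem_mergeCollect [Add R] {q : List (R × List JVar)} {t : R × List JVar} (ht : t ∈ mergeCollect q) :
    ∃ s ∈ q, t.2 = s.2 := by
  cases q with
  | nil => simp [mergeCollect] at ht
  | cons u rest => exact snd_mem_collectAcc u rest t ht

/-- Collecting a `monoCmp`-sorted list gives STRICTLY increasing monomials. -/
theorem collectAcc_pairwise_lt [Add R] : ∀ (cur : R × List JVar) (rest : List (R × List JVar)),
    (cur :: rest).Pairwise (fun s t => monoCmp s.2 t.2 ≠ .gt) →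
    (collectAcc cur rest).Pairwise (fun s t => monoCmp s.2 t.2 = .lt)
  | cur, [], _ => by simp [collectAcc]
  | cur, u :: rest, h => by
    obtain ⟨h₁, h₂⟩ := List.pairwise_cons.1 h
    obtain ⟨h₃, h₄⟩ := List.pairwise_cons.1 h₂
    simp only [collectAcc]
    split_ifs with hcu
    · exact collectAcc_pairwise_lt _ rest (List.pairwise_cons.2 ⟨fun x hx => h₁ x (List.mem_cons_of_mem _ hx), h₄⟩)
    · refine List.pairwise_cons.2 ⟨fun x hx => ?_, collectAcc_pairwise_lt u rest h₂⟩
      obtain ⟨s, hs, hxs⟩ := snd_mem_collectAcc u rest x hx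
      rw [hxs]
      have hle : monoCmp cur.2 s.2 ≠ .gt := h₁ s hs
      cases hc : monoCmp cur.2 s.2 with
      | lt => rfl
      | gt => exact absurd hc hle
      | eq =>
        have hcs : cur.2 = s.2 := eq_of_monoCmp_eq _ _ hc
        rcases List.mem_cons.1 hs with rfl | hs
        · exact absurd hcs hcu
        · exact absurd (monoCmp_antisymm (h₁ u List.mem_cons_self) (hcs ▸ h₃ s hs)) hcu

/-- `mergeCollect` of a `monoCmp`-sorted list has strictly increasing monomials. -/
theorem mergeCollect_pairwise_lt [Add R] {q : List (R × List JVar)}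
    (h : q.Pairwise (fun s t => monoCmp s.2 t.2 ≠ .gt)) :
    (mergeCollect q).Pairwise (fun s t => monoCmp s.2 t.2 = .lt) := by
  cases q with
  | nil => exact List.Pairwise.nil
  | cons u rest => exact collectAcc_pairwise_lt u rest h

/-- `collectAcc` commutes with an ADDITIVE map of the coefficients. -/
theorem collectAcc_map [Add R] [Add S] (φ : R → S) (hadd : ∀ a b, φ (a + b) = φ a + φ b) :
    ∀ (cur : R × List JVar) (rest : List (R × List JVar)),
    collectAcc (φ cur.1, cur.2) (rest.map fun t => (φ t.1, t.2)) = (collectAcc cur rest).map fun t => (φ t.1, t.2)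
  | cur, [] => rfl
  | cur, u :: rest => by
    simp only [List.map_cons, collectAcc]
    split_ifs with h
    · rw [← hadd]
      exact collectAcc_map φ hadd (cur.1 + u.1, cur.2) rest
    · rw [List.map_cons, ← collectAcc_map φ hadd u rest]

/-- `mergeCollect` commutes with an additive map of the coefficients. -/
theorem mergeCollect_map [Add R] [Add S] (φ : R → S) (hadd : ∀ a b, φ (a + b) = φ a + φ b)
    (q : List (R × List JVar)) :
    mergeCollect (q.map fun t => (φ t.1, t.2)) = (mergeCollect q).map fun t => (φ t.1, t.2) := by
  cases q with
  | nil => rfl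
  | cons u rest => exact collectAcc_map φ hadd u rest

/-- The zero filter commutes with a map of the coefficients that reflects and preserves `0`. -/
theorem filter_ne_zero_map [Zero R] [DecidableEq R] [Zero S] [DecidableEq S] (φ : R → S)
    (hzero : ∀ a, φ a = 0 ↔ a = 0) (q : List (R × List JVar)) :
    ((q.map fun t => (φ t.1, t.2)).filter fun t => t.1 ≠ 0) =
      (q.filter fun t => t.1 ≠ 0).map fun t => (φ t.1, t.2) := by
  rw [List.filter_map]
  congr 1
  exact List.filter_congr fun t _ => by simp [hzero]

/-- **`normF` commutes with an additive, zero-reflecting map of the coefficients** (e.g. the casts `ℤ → ℝ`,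
`ℚ → ℝ`): merging and sorting never look at coefficients, collecting adds them, the filter tests them for `0`. -/
theorem normF_map [Add R] [Zero R] [DecidableEq R] [Add S] [Zero S] [DecidableEq S] (φ : R → S)
    (hadd : ∀ a b, φ (a + b) = φ a + φ b) (hzero : ∀ a, φ a = 0 ↔ a = 0) (p : JPoly R) :
    normF (p.map fun t => (φ t.1, t.2)) = (normF p).map fun t => (φ t.1, t.2) := by
  have hc : (p.map fun t => (φ t.1, t.2)).map (fun t => (t.1, sortVars t.2)) =
      (p.map fun t => (t.1, sortVars t.2)).map fun t => (φ t.1, t.2) := by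
    rw [List.map_map, List.map_map]; rfl
  unfold normF
  rw [List.length_map, hc, msort_map, mergeCollect_map φ hadd, filter_ne_zero_map φ hzero]

end JPoly

/-! ### The registered helper stub -/

/-- **Helper stub `msort_perm_sorted` of crux `OddMorawetzLocal` (refutation, split of `normF_semantics`).**
Merge sort with fuel at least the length of the list returns a permutation of the list whose monomials are
`monoCmp`-non-decreasing. -/
theorem msort_perm_sorted {R : Type} (fuel : ℕ) (p : List (R × List JVar)) (h : p.length ≤ fuel) :
    (JPoly.msort fuel p).Perm p ∧ (JPoly.msort fuel p).Pairwise fun s t => monoCmp s.2 t.2 ≠ Ordering.gt :=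
  ⟨JPoly.msort_perm fuel p, JPoly.msort_sorted fuel p h⟩

end Summit.NavierStokesRegularity.NavierStokesRegularity.Theorems.OddMorawetz

end
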